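import Mathlib
import Literature.Geometry.Lorentzian.Basic
import Literature.Analysis.Calculus.PolarCoordinatesE3

/-!
# Route StarvedNecks — crux `NecksCertify`, line `two-cap-focusing-ledger`: stub M2, sphere means

Helper file for `stub_huygensNeck`: the measure theory of the three Kirchhoff terms over the unit
sphere `S²` (`σ = volume.toSphere`).  `abs_average_le` (an average is bounded by a pointwise
bound); `abs_focusing_le` (the focusing term `σ ⨍ h` with `|h| ≤ 2FP`, `σ² ∫ F² ≤ e` is
`≤ P (λ/2 + 2e/(λ σ(S²)))`, pointwise AM–GM); `exists_radius_sphere_lintegral_le` (polar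
coordinates about `x` and the first-moment pigeonhole: `∫_{a ≤ |z−x| ≤ b} G ≤ e (b − a)` gives a
radius `σ ∈ [a, b]` with `σ² ∫_{S²} G(x + σw) ≤ e`); `lintegral_radial_indicator_le`,
`abs_duhamel_le` (the Duhamel geometry `∫₀^∞ s ∫_{S²} 1_{B(0,R)}(x + sw) = ∫_{B(0,R)} dz/|z−x| ≤
σ(S²) + vol B(0,R)` uniformly in `x`).  Mathlib plus the tree's polar-coordinate formula; no
definitions, no named facts.
-/

noncomputable section

namespace Summit.FinalStateConjecture.FinalStateConjecture.Theorems.NecksCertifyTwoCap.Huygens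

open scoped Topology ENNReal
open Filter Set MeasureTheory Metric Literature.Geometry.Lorentzian

set_option linter.dupNamespace false

/-! ### The sphere measure -/

/-- The total mass of the unit sphere of `E3` is positive and finite (as a real number). -/
theorem toSphere_univ_toReal_pos :
    0 < (((volume : Measure E3).toSphere) univ).toReal := by
  refine ENNReal.toReal_pos ?_ (measure_ne_top _ _)
  exact (Measure.measure_univ_ne_zero).2 (Measure.toSphere_ne_zero _)

/-! ### Second Kirchhoff term: focusing paid by an `L²` bound -/

/-- Pointwise AM–GM in the form used below: `t ≤ λ/2 + t²/(2λ)` for `λ > 0`. -/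
theorem le_half_add_sq_div {t lam : ℝ} (hlam : 0 < lam) : t ≤ lam / 2 + t ^ 2 / (2 * lam) := by
  rw [div_add_div _ _ (by positivity) (by positivity), le_div_iff₀ (by positivity)]
  nlinarith [sq_nonneg (t - lam)]

/-- **The focusing term.**  If `|h(w)| ≤ 2 F(w) P` on the sphere and `σ² ∫ F² dσ ≤ e`, then
`|σ ⨍ h| ≤ P (λ/2 + 2e/(λ σ(S²)))` for every `λ > 0`. -/
theorem abs_focusing_le {h F : sphere (0 : E3) 1 → ℝ} {σ P e lam : ℝ} (hσ : 0 ≤ σ) (hP : 0 ≤ P)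
    (he : 0 ≤ e) (hlam : 0 < lam) (hbound : ∀ w, |h w| ≤ 2 * F w * P)
    (hL2 : ∫⁻ w, ENNReal.ofReal (σ ^ 2 * F w ^ 2) ∂((volume : Measure E3).toSphere) ≤
      ENNReal.ofReal e) :
    |σ * (((((volume : Measure E3).toSphere) univ).toReal)⁻¹ *
        ∫ w, h w ∂((volume : Measure E3).toSphere))| ≤
      P * (lam / 2 + 2 * e / (lam * (((volume : Measure E3).toSphere) univ).toReal)) := by
  set μ : Measure (sphere (0 : E3) 1) := (volume : Measure E3).toSphere with hμ
  set c : ℝ := (μ univ).toReal with hcdef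
  have hc : 0 < c := toSphere_univ_toReal_pos
  -- pointwise bound `σ |h| ≤ P λ/2 + (P/λ) σ² F²`
  have hpt : ∀ w, σ * |h w| ≤ P * lam / 2 + 2 * P / lam * (σ ^ 2 * F w ^ 2) := by
    intro w
    have h1 : σ * |h w| ≤ (2 * σ * F w) * P := by nlinarith [hbound w, abs_nonneg (h w)]
    have h2 : 2 * σ * F w ≤ lam / 2 + (2 * σ * F w) ^ 2 / (2 * lam) := le_half_add_sq_div hlam
    have h3 : (2 * σ * F w) * P ≤ (lam / 2 + (2 * σ * F w) ^ 2 / (2 * lam)) * P :=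
      mul_le_mul_of_nonneg_right h2 hP
    have h4 : (lam / 2 + (2 * σ * F w) ^ 2 / (2 * lam)) * P =
        P * lam / 2 + 2 * P / lam * (σ ^ 2 * F w ^ 2) := by
      field_simp
    linarith
  -- integrate
  have hint : ∫⁻ w, ENNReal.ofReal (σ * |h w|) ∂μ ≤
      ENNReal.ofReal (P * lam / 2) * μ univ + ENNReal.ofReal (2 * P / lam) * ENNReal.ofReal e := by
    calc ∫⁻ w, ENNReal.ofReal (σ * |h w|) ∂μ
        ≤ ∫⁻ w, (ENNReal.ofReal (P * lam / 2) +
            ENNReal.ofReal (2 * P / lam) * ENNReal.ofReal (σ ^ 2 * F w ^ 2)) ∂μ := by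
          refine lintegral_mono fun w ↦ ?_
          rw [← ENNReal.ofReal_mul (by positivity), ← ENNReal.ofReal_add (by positivity)
            (by positivity)]
          exact ENNReal.ofReal_le_ofReal (hpt w)
      _ = ENNReal.ofReal (P * lam / 2) * μ univ +
            ENNReal.ofReal (2 * P / lam) * ∫⁻ w, ENNReal.ofReal (σ ^ 2 * F w ^ 2) ∂μ := by
          rw [lintegral_add_left measurable_const, lintegral_const,
            lintegral_const_mul' _ _ ENNReal.ofReal_ne_top]
      _ ≤ _ := by gcongr
  -- from the integral of `|h|` to `|∫ h|`
  have habs : |∫ w, h w ∂μ| ≤ (∫⁻ w, ‖h w‖ₑ ∂μ).toReal := by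
    have := norm_integral_le_lintegral_norm (μ := μ) h
    rw [Real.norm_eq_abs] at this
    refine this.trans (le_of_eq ?_)
    congr 1
    exact lintegral_congr fun w ↦ (ofReal_norm _)
  have hfin : ENNReal.ofReal (P * lam / 2) * μ univ + ENNReal.ofReal (2 * P / lam) * ENNReal.ofReal e
      ≠ ∞ := by
    refine ENNReal.add_ne_top.2 ⟨ENNReal.mul_ne_top ENNReal.ofReal_ne_top (measure_ne_top _ _),
      ENNReal.mul_ne_top ENNReal.ofReal_ne_top ENNReal.ofReal_ne_top⟩
  have hσint : σ * (∫⁻ w, ‖h w‖ₑ ∂μ).toReal ≤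
      (ENNReal.ofReal (P * lam / 2) * μ univ + ENNReal.ofReal (2 * P / lam) * ENNReal.ofReal e).toReal := by
    have heq : ENNReal.ofReal σ * ∫⁻ w, ‖h w‖ₑ ∂μ = ∫⁻ w, ENNReal.ofReal (σ * |h w|) ∂μ := by
      rw [← lintegral_const_mul' _ _ ENNReal.ofReal_ne_top]
      refine lintegral_congr fun w ↦ ?_
      rw [Real.enorm_eq_ofReal_abs, ← ENNReal.ofReal_mul hσ]
    have h1 : ENNReal.ofReal σ * ∫⁻ w, ‖h w‖ₑ ∂μ ≤ _ := heq ▸ hint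
    have h2 := ENNReal.toReal_mono hfin h1
    rwa [ENNReal.toReal_mul, ENNReal.toReal_ofReal hσ] at h2
  rw [abs_mul, abs_mul, abs_of_nonneg hσ, abs_inv, abs_of_pos hc]
  calc σ * (c⁻¹ * |∫ w, h w ∂μ|) = c⁻¹ * (σ * |∫ w, h w ∂μ|) := by ring
    _ ≤ c⁻¹ * (σ * (∫⁻ w, ‖h w‖ₑ ∂μ).toReal) := by gcongr
    _ ≤ c⁻¹ * (ENNReal.ofReal (P * lam / 2) * μ univ +
          ENNReal.ofReal (2 * P / lam) * ENNReal.ofReal e).toReal := by gcongr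
    _ = c⁻¹ * (P * lam / 2 * c + 2 * P / lam * e) := by
        rw [ENNReal.toReal_add (ENNReal.mul_ne_top ENNReal.ofReal_ne_top (measure_ne_top _ _))
          (ENNReal.mul_ne_top ENNReal.ofReal_ne_top ENNReal.ofReal_ne_top),
          ENNReal.toReal_mul, ENNReal.toReal_mul, ENNReal.toReal_ofReal (by positivity),
          ENNReal.toReal_ofReal (by positivity), ENNReal.toReal_ofReal he]
    _ = P * (lam / 2 + 2 * e / (lam * c)) := by
        field_simp

/-! ### Polar coordinates about a centre -/

/-- Measurability of `(w, r) ↦ Φ(r w) r²` on `S² × ℝ`. -/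
theorem measurable_sphere_radial {Φ : E3 → ℝ≥0∞} (hΦ : Measurable Φ) :
    Measurable fun p : sphere (0 : E3) 1 × ℝ ↦ Φ (p.2 • (p.1 : E3)) * ENNReal.ofReal (p.2 ^ 2) := by
  have hg : Continuous fun p : sphere (0 : E3) 1 × ℝ ↦ p.2 • (p.1 : E3) :=
    continuous_snd.smul (continuous_subtype_val.comp continuous_fst)
  exact (hΦ.comp hg.measurable).mul
    (ENNReal.measurable_ofReal.comp ((continuous_pow 2).comp continuous_snd).measurable)

/-- **Polar coordinates, radial integral outside**: `∫ Φ = ∫_0^∞ (∫_{S²} Φ(rw) dσ(w)) r² dr`. -/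
theorem lintegral_eq_lintegral_Ioi_sphere {Φ : E3 → ℝ≥0∞} (hΦ : Measurable Φ) :
    ∫⁻ u, Φ u = ∫⁻ r in Ioi (0 : ℝ), (∫⁻ w, Φ (r • (w : E3)) ∂(volume : Measure E3).toSphere) *
      ENNReal.ofReal (r ^ 2) := by
  rw [Literature.Analysis.Calculus.lintegral_eq_lintegral_sphere_Ioi Φ hΦ,
    lintegral_lintegral_swap ((measurable_sphere_radial hΦ).aemeasurable)]
  refine setLIntegral_congr_fun measurableSet_Ioi fun r _ ↦ ?_
  rw [lintegral_mul_const' _ _ ENNReal.ofReal_ne_top]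

/-- The norm of `r w` for `w ∈ S²`, `r > 0`. -/
theorem norm_smul_sphere {r : ℝ} (hr : 0 < r) (w : sphere (0 : E3) 1) : ‖r • (w : E3)‖ = r := by
  rw [norm_smul, Real.norm_eq_abs, abs_of_pos hr, norm_eq_of_mem_sphere w, mul_one]

/-- **Pigeonhole on the cone shell.**  If `G ≥ 0` is continuous and
`∫_{a ≤ |z − x| ≤ b} G ≤ e (b − a)` (`0 < a < b`), then for some radius `σ ∈ [a, b]`,
`σ² ∫_{S²} G(x + σ w) dσ(w) ≤ e`. -/
theorem exists_radius_sphere_lintegral_le {G : E3 → ℝ} {x : E3} {a b e : ℝ} (ha : 0 < a)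
    (hab : a < b) (hG : Continuous G) (hG0 : ∀ z, 0 ≤ G z)
    (hint : ∫ z in {z : E3 | a ≤ ‖z - x‖ ∧ ‖z - x‖ ≤ b}, G z ≤ e * (b - a)) :
    ∃ σ ∈ Icc a b, ∫⁻ w, ENNReal.ofReal (σ ^ 2 * G (x + σ • (w : E3)))
      ∂(volume : Measure E3).toSphere ≤ ENNReal.ofReal e := by
  set μS : Measure (sphere (0 : E3) 1) := (volume : Measure E3).toSphere with hμS
  set A : Set E3 := {z : E3 | a ≤ ‖z - x‖ ∧ ‖z - x‖ ≤ b} with hA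
  have hAeq : A = (fun z : E3 ↦ ‖z - x‖) ⁻¹' Icc a b := rfl
  have hcont : Continuous fun z : E3 ↦ ‖z - x‖ := (continuous_id.sub continuous_const).norm
  have hAcl : IsClosed A := hAeq ▸ isClosed_Icc.preimage hcont
  have hAm : MeasurableSet A := hAcl.measurableSet
  have hAc : IsCompact A := (isCompact_closedBall x b).of_isClosed_subset hAcl fun z hz ↦
    mem_closedBall.2 (by rw [dist_eq_norm]; exact hz.2)
  have hGi : IntegrableOn G A := hG.continuousOn.integrableOn_compact hAc
  -- lintegral form of the hypothesis
  have h2 : ∫⁻ z in A, ENNReal.ofReal (G z) ≤ ENNReal.ofReal (e * (b - a)) := by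
    rw [← ofReal_integral_eq_lintegral_ofReal hGi (ae_of_all _ fun z ↦ hG0 z)]
    exact ENNReal.ofReal_le_ofReal hint
  -- translate and go polar
  set Φ : E3 → ℝ≥0∞ := fun u ↦ A.indicator (fun z ↦ ENNReal.ofReal (G z)) (x + u) with hΦ
  have hΦm : Measurable Φ :=
    ((ENNReal.measurable_ofReal.comp hG.measurable).indicator hAm).comp (measurable_const_add x)
  have h3 : ∫⁻ u, Φ u = ∫⁻ z in A, ENNReal.ofReal (G z) := by
    rw [← lintegral_indicator hAm]
    exact lintegral_add_left_eq_self (μ := (volume : Measure E3))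
      (fun z ↦ A.indicator (fun z ↦ ENNReal.ofReal (G z)) z) x
  set I : ℝ → ℝ≥0∞ := fun r ↦ ∫⁻ w, ENNReal.ofReal (r ^ 2 * G (x + r • (w : E3))) ∂μS with hI
  have h5 : ∀ r ∈ Ioi (0 : ℝ), (∫⁻ w, Φ (r • (w : E3)) ∂μS) * ENNReal.ofReal (r ^ 2) =
      (Icc a b).indicator I r := by
    intro r hr
    have hnorm : ∀ w : sphere (0 : E3) 1, ‖x + r • (w : E3) - x‖ = r := fun w ↦ by
      rw [add_sub_cancel_left, norm_smul_sphere hr w]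
    by_cases hr' : r ∈ Icc a b
    · rw [indicator_of_mem hr', hI]
      simp only
      rw [← lintegral_mul_const' _ _ ENNReal.ofReal_ne_top]
      refine lintegral_congr fun w ↦ ?_
      have hmem : x + r • (w : E3) ∈ A := by
        rw [hA, mem_setOf_eq, hnorm w]; exact hr'
      rw [hΦ]
      simp only
      rw [indicator_of_mem hmem, ← ENNReal.ofReal_mul (hG0 _), mul_comm]
    · rw [indicator_of_notMem hr']
      have h0 : ∀ w : sphere (0 : E3) 1, Φ (r • (w : E3)) = 0 := by
        intro w
        have hnmem : x + r • (w : E3) ∉ A := by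
          rw [hA, mem_setOf_eq, hnorm w]; exact hr'
        rw [hΦ]
        simp only
        rw [indicator_of_notMem hnmem]
      simp [h0]
  have h6 : ∫⁻ u, Φ u = ∫⁻ r in Icc a b, I r := by
    have hsub : Icc a b ∩ Ioi 0 = Icc a b :=
      inter_eq_left.2 fun r hr ↦ mem_Ioi.2 (ha.trans_le hr.1)
    rw [lintegral_eq_lintegral_Ioi_sphere hΦm, setLIntegral_congr_fun measurableSet_Ioi h5,
      lintegral_indicator measurableSet_Icc, Measure.restrict_restrict measurableSet_Icc, hsub]
  -- pigeonhole
  have hIcc : volume (Icc a b) = ENNReal.ofReal (b - a) := Real.volume_Icc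
  have hne : volume (Icc a b) ≠ 0 := by
    rw [hIcc]; exact (ENNReal.ofReal_pos.2 (by linarith)).ne'
  have hImeas : Measurable I := by
    have hf : Measurable fun p : ℝ × sphere (0 : E3) 1 ↦
        ENNReal.ofReal (p.1 ^ 2 * G (x + p.1 • (p.2 : E3))) :=
      ENNReal.measurable_ofReal.comp (((continuous_pow 2).comp continuous_fst).mul
        (hG.comp (continuous_const.add (continuous_fst.smul
          (continuous_subtype_val.comp continuous_snd))))).measurable
    exact hf.lintegral_prod_right'
  obtain ⟨σ, hσ, hle⟩ := exists_le_setLAverage hne (by rw [hIcc]; exact ENNReal.ofReal_ne_top)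
    hImeas.aemeasurable
  refine ⟨σ, hσ, hle.trans ?_⟩
  rw [setLAverage_eq, hIcc]
  calc (∫⁻ r in Icc a b, I r) / ENNReal.ofReal (b - a)
      ≤ ENNReal.ofReal (e * (b - a)) / ENNReal.ofReal (b - a) := by
        gcongr
        calc ∫⁻ r in Icc a b, I r = ∫⁻ z in A, ENNReal.ofReal (G z) := by rw [← h6, h3]
          _ ≤ _ := h2
    _ = ENNReal.ofReal e := by
        rw [ENNReal.ofReal_mul' (by linarith : (0 : ℝ) ≤ b - a),
          ENNReal.mul_div_cancel_right ((ENNReal.ofReal_pos.2 (by linarith)).ne')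
            ENNReal.ofReal_ne_top]

/-! ### Duhamel term: the geometry of late emission -/

/-- **`∫₀^∞ s ∫_{S²} 1_{B(0,R)}(x + sw) dσ(w) ds ≤ σ(S²) + vol B(0,R)`**, uniformly in the centre
`x` (polar coordinates: the left side is `∫_{B(0,R)} dz / |z − x|`). -/
theorem lintegral_radial_indicator_le (x : E3) (R : ℝ) :
    ∫⁻ s in Ioi (0 : ℝ), ENNReal.ofReal s *
        ∫⁻ w, (closedBall (0 : E3) R).indicator (fun _ ↦ (1 : ℝ≥0∞)) (x + s • (w : E3))
          ∂(volume : Measure E3).toSphere ≤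
      (volume : Measure E3).toSphere univ + volume (closedBall (0 : E3) R) := by
  set μS : Measure (sphere (0 : E3) 1) := (volume : Measure E3).toSphere with hμS
  set B : Set E3 := closedBall (0 : E3) R with hB
  set Φ : E3 → ℝ≥0∞ := fun u ↦ B.indicator (fun _ ↦ (1 : ℝ≥0∞)) (x + u) * (ENNReal.ofReal ‖u‖)⁻¹
    with hΦ
  have hΦm : Measurable Φ :=
    ((measurable_const.indicator measurableSet_closedBall).comp (measurable_const_add x)).mul
      (ENNReal.measurable_ofReal.comp measurable_norm).inv
  -- the left side is `∫ Φ`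
  have h1 : ∫⁻ s in Ioi (0 : ℝ), ENNReal.ofReal s *
      ∫⁻ w, B.indicator (fun _ ↦ (1 : ℝ≥0∞)) (x + s • (w : E3)) ∂μS = ∫⁻ u, Φ u := by
    rw [lintegral_eq_lintegral_Ioi_sphere hΦm]
    refine setLIntegral_congr_fun measurableSet_Ioi fun r hr ↦ ?_
    rw [← lintegral_const_mul' _ _ ENNReal.ofReal_ne_top,
      ← lintegral_mul_const' _ _ ENNReal.ofReal_ne_top]
    refine lintegral_congr fun w ↦ ?_
    have hinv : (ENNReal.ofReal r)⁻¹ * ENNReal.ofReal (r ^ 2) = ENNReal.ofReal r := by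
      rw [pow_two, ENNReal.ofReal_mul (le_of_lt hr), ← mul_assoc,
        ENNReal.inv_mul_cancel ((ENNReal.ofReal_pos.2 hr).ne') ENNReal.ofReal_ne_top, one_mul]
    rw [hΦ]
    simp only
    rw [norm_smul_sphere hr w, mul_assoc, hinv, mul_comm]
  -- translate to the centre
  have h2 : ∫⁻ u, Φ u =
      ∫⁻ z, B.indicator (fun _ ↦ (1 : ℝ≥0∞)) z * (ENNReal.ofReal ‖z - x‖)⁻¹ := by
    rw [← lintegral_add_left_eq_self (μ := (volume : Measure E3))
      (fun z ↦ B.indicator (fun _ ↦ (1 : ℝ≥0∞)) z * (ENNReal.ofReal ‖z - x‖)⁻¹) x]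
    simp [hΦ, add_sub_cancel_left]
  -- pointwise splitting
  have h3 : ∀ z : E3, B.indicator (fun _ ↦ (1 : ℝ≥0∞)) z * (ENNReal.ofReal ‖z - x‖)⁻¹ ≤
      (closedBall x 1).indicator (fun z ↦ (ENNReal.ofReal ‖z - x‖)⁻¹) z +
        B.indicator (fun _ ↦ (1 : ℝ≥0∞)) z := by
    intro z
    by_cases hz : z ∈ B
    · rw [indicator_of_mem hz, one_mul]
      by_cases hzx : z ∈ closedBall x 1
      · rw [indicator_of_mem hzx]; exact le_self_add
      · rw [indicator_of_notMem hzx, zero_add]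
        have h1' : 1 ≤ ‖z - x‖ := by
          rw [mem_closedBall, dist_eq_norm, not_le] at hzx; exact hzx.le
        calc (ENNReal.ofReal ‖z - x‖)⁻¹ ≤ 1 :=
              ENNReal.inv_le_one.2 (by rw [← ENNReal.ofReal_one]; exact ENNReal.ofReal_le_ofReal h1')
          _ = (1 : ℝ≥0∞) := rfl
    · rw [indicator_of_notMem hz, zero_mul]; exact bot_le
  -- the singular part: `∫_{|u| ≤ 1} du/|u| ≤ σ(S²)`
  have h4 : ∫⁻ z, (closedBall x 1).indicator (fun z ↦ (ENNReal.ofReal ‖z - x‖)⁻¹) z ≤ μS univ := by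
    have htr : ∫⁻ z, (closedBall x 1).indicator (fun z ↦ (ENNReal.ofReal ‖z - x‖)⁻¹) z =
        ∫⁻ u : E3, (Iic (1 : ℝ)).indicator (fun r ↦ (ENNReal.ofReal r)⁻¹) ‖u‖ := by
      rw [← lintegral_add_left_eq_self (μ := (volume : Measure E3))
        (fun z ↦ (closedBall x 1).indicator (fun z ↦ (ENNReal.ofReal ‖z - x‖)⁻¹) z) x]
      refine lintegral_congr fun u ↦ ?_
      by_cases hu : ‖u‖ ≤ 1
      · have hmem : x + u ∈ closedBall x 1 := by
          rw [mem_closedBall, dist_eq_norm, add_sub_cancel_left]; exact hu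
        rw [indicator_of_mem hmem, indicator_of_mem (mem_Iic.2 hu)]
        simp only [add_sub_cancel_left]
      · have hnmem : x + u ∉ closedBall x 1 := by
          rw [mem_closedBall, dist_eq_norm, add_sub_cancel_left]; exact hu
        rw [indicator_of_notMem hnmem, indicator_of_notMem (by simpa using hu)]
    rw [htr, Literature.Analysis.Calculus.lintegral_radial_eq
      (fun r ↦ (Iic (1 : ℝ)).indicator (fun r ↦ (ENNReal.ofReal r)⁻¹) r)
      ((ENNReal.measurable_ofReal.inv).indicator measurableSet_Iic)]
    calc μS univ * ∫⁻ r in Ioi (0 : ℝ), (Iic (1 : ℝ)).indicator (fun r ↦ (ENNReal.ofReal r)⁻¹) r *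
          ENNReal.ofReal (r ^ 2)
        ≤ μS univ * ∫⁻ r in Ioi (0 : ℝ), (Iic (1 : ℝ)).indicator (fun _ ↦ (1 : ℝ≥0∞)) r := by
          gcongr μS univ * ?_
          refine setLIntegral_mono' measurableSet_Ioi fun r hr ↦ ?_
          by_cases hr1 : r ∈ Iic (1 : ℝ)
          · rw [indicator_of_mem hr1, indicator_of_mem hr1, pow_two,
              ENNReal.ofReal_mul (le_of_lt hr), ← mul_assoc,
              ENNReal.inv_mul_cancel ((ENNReal.ofReal_pos.2 hr).ne') ENNReal.ofReal_ne_top, one_mul,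
              ← ENNReal.ofReal_one]
            exact ENNReal.ofReal_le_ofReal hr1
          · rw [indicator_of_notMem hr1, indicator_of_notMem hr1, zero_mul]
      _ = μS univ * volume (Ioc (0 : ℝ) 1) := by
          rw [lintegral_indicator measurableSet_Iic, Measure.restrict_restrict measurableSet_Iic,
            setLIntegral_const, one_mul, Iic_inter_Ioi]
      _ ≤ μS univ := by rw [Real.volume_Ioc]; simp
  -- the bounded part
  have h5 : ∫⁻ z, B.indicator (fun _ ↦ (1 : ℝ≥0∞)) z = volume B :=
    lintegral_indicator_one measurableSet_closedBall
  rw [h1, h2]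
  calc ∫⁻ z, B.indicator (fun _ ↦ (1 : ℝ≥0∞)) z * (ENNReal.ofReal ‖z - x‖)⁻¹
      ≤ ∫⁻ z, ((closedBall x 1).indicator (fun z ↦ (ENNReal.ofReal ‖z - x‖)⁻¹) z +
          B.indicator (fun _ ↦ (1 : ℝ≥0∞)) z) := lintegral_mono h3
    _ = (∫⁻ z, (closedBall x 1).indicator (fun z ↦ (ENNReal.ofReal ‖z - x‖)⁻¹) z) +
          ∫⁻ z, B.indicator (fun _ ↦ (1 : ℝ≥0∞)) z := by
        rw [lintegral_add_left]
        exact ((ENNReal.measurable_ofReal.comp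
          ((continuous_id.sub continuous_const).norm).measurable).inv).indicator
            measurableSet_closedBall
    _ ≤ μS univ + volume B := by rw [h5]; gcongr

/-- **The Duhamel term.**  If `|Q(s, w)| ≤ A · 1_{B(0,R)}(x + sw)` for `0 < s ≤ σ`, then
`|∫₀^σ s ⨍ Q(s, ·) ds| ≤ σ(S²)⁻¹ A (σ(S²) + vol B(0,R))`. -/
theorem abs_duhamel_le {Q : ℝ → sphere (0 : E3) 1 → ℝ} {x : E3} {R A σ : ℝ} (hA : 0 ≤ A)
    (hσ : 0 ≤ σ) (hQ : ∀ s, 0 < s → s ≤ σ → ∀ w, |Q s w| ≤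
      A * (closedBall (0 : E3) R).indicator (fun _ ↦ (1 : ℝ)) (x + s • (w : E3))) :
    |∫ s in (0 : ℝ)..σ, s * (((((volume : Measure E3).toSphere) univ).toReal)⁻¹ *
        ∫ w, Q s w ∂((volume : Measure E3).toSphere))| ≤
      ((((volume : Measure E3).toSphere) univ).toReal)⁻¹ * A *
        ((volume : Measure E3).toSphere univ + volume (closedBall (0 : E3) R)).toReal := by
  set μS : Measure (sphere (0 : E3) 1) := (volume : Measure E3).toSphere with hμS
  set c : ℝ := (μS univ).toReal with hcdef
  have hc : 0 < c := toSphere_univ_toReal_pos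
  set B : Set E3 := closedBall (0 : E3) R with hB
  rw [intervalIntegral.integral_of_le hσ]
  -- pointwise bound on `Ioc 0 σ`
  have hpt : ∀ s ∈ Ioc (0 : ℝ) σ, ‖s * (c⁻¹ * ∫ w, Q s w ∂μS)‖ₑ ≤ ENNReal.ofReal (c⁻¹ * A) *
      (ENNReal.ofReal s * ∫⁻ w, B.indicator (fun _ ↦ (1 : ℝ≥0∞)) (x + s • (w : E3)) ∂μS) := by
    intro s hs
    have hQe : ∀ w, ‖Q s w‖ₑ ≤
        ENNReal.ofReal A * B.indicator (fun _ ↦ (1 : ℝ≥0∞)) (x + s • (w : E3)) := by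
      intro w
      rw [Real.enorm_eq_ofReal_abs]
      refine (ENNReal.ofReal_le_ofReal (hQ s hs.1 hs.2 w)).trans (le_of_eq ?_)
      by_cases hmem : x + s • (w : E3) ∈ B
      · rw [indicator_of_mem hmem, indicator_of_mem hmem, mul_one, mul_one]
      · rw [indicator_of_notMem hmem, indicator_of_notMem hmem, mul_zero, mul_zero,
          ENNReal.ofReal_zero]
    rw [enorm_mul, enorm_mul, Real.enorm_eq_ofReal hs.1.le,
      Real.enorm_eq_ofReal (inv_nonneg.2 hc.le), ENNReal.ofReal_mul (inv_nonneg.2 hc.le)]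
    calc ENNReal.ofReal s * (ENNReal.ofReal c⁻¹ * ‖∫ w, Q s w ∂μS‖ₑ)
        ≤ ENNReal.ofReal s * (ENNReal.ofReal c⁻¹ * ∫⁻ w, ‖Q s w‖ₑ ∂μS) := by
          gcongr; exact enorm_integral_le_lintegral_enorm _
      _ ≤ ENNReal.ofReal s * (ENNReal.ofReal c⁻¹ * ∫⁻ w,
            ENNReal.ofReal A * B.indicator (fun _ ↦ (1 : ℝ≥0∞)) (x + s • (w : E3)) ∂μS) := by
          gcongr with w; exact hQe w
      _ = _ := by
          rw [lintegral_const_mul' _ _ ENNReal.ofReal_ne_top]; ring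
  -- integrate
  have hint : ∫⁻ s in Ioc (0 : ℝ) σ, ‖s * (c⁻¹ * ∫ w, Q s w ∂μS)‖ₑ ≤
      ENNReal.ofReal (c⁻¹ * A) * (μS univ + volume B) := by
    calc ∫⁻ s in Ioc (0 : ℝ) σ, ‖s * (c⁻¹ * ∫ w, Q s w ∂μS)‖ₑ
        ≤ ∫⁻ s in Ioc (0 : ℝ) σ, ENNReal.ofReal (c⁻¹ * A) *
            (ENNReal.ofReal s * ∫⁻ w, B.indicator (fun _ ↦ (1 : ℝ≥0∞)) (x + s • (w : E3)) ∂μS) :=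
          setLIntegral_mono' measurableSet_Ioc hpt
      _ ≤ ∫⁻ s in Ioi (0 : ℝ), ENNReal.ofReal (c⁻¹ * A) *
            (ENNReal.ofReal s * ∫⁻ w, B.indicator (fun _ ↦ (1 : ℝ≥0∞)) (x + s • (w : E3)) ∂μS) :=
          lintegral_mono_set Ioc_subset_Ioi_self
      _ = ENNReal.ofReal (c⁻¹ * A) * ∫⁻ s in Ioi (0 : ℝ),
            ENNReal.ofReal s * ∫⁻ w, B.indicator (fun _ ↦ (1 : ℝ≥0∞)) (x + s • (w : E3)) ∂μS :=
          lintegral_const_mul' _ _ ENNReal.ofReal_ne_top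
      _ ≤ _ := by gcongr; exact lintegral_radial_indicator_le x R
  have hfin : ENNReal.ofReal (c⁻¹ * A) * (μS univ + volume B) ≠ ∞ :=
    ENNReal.mul_ne_top ENNReal.ofReal_ne_top
      (ENNReal.add_ne_top.2 ⟨measure_ne_top _ _, measure_closedBall_lt_top.ne⟩)
  have h1 := norm_integral_le_lintegral_norm (μ := volume.restrict (Ioc (0 : ℝ) σ))
    (fun s ↦ s * (c⁻¹ * ∫ w, Q s w ∂μS))
  rw [Real.norm_eq_abs] at h1
  refine h1.trans ?_
  have h2 := ENNReal.toReal_mono hfin hint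
  rw [ENNReal.toReal_mul, ENNReal.toReal_ofReal (by positivity)] at h2
  refine le_trans (le_of_eq ?_) h2
  congr 1
  exact lintegral_congr fun s ↦ (ofReal_norm _)

/-! ### Registered sub-goal -/

/-- Registered sub-goal of `stub_huygensNeck` (sphere means): statement of
`exists_radius_sphere_lintegral_le`. -/
theorem stub_huygensNeck_coneRadius : ∀ (G : E3 → ℝ) (x : E3) (a b e : ℝ), 0 < a → a < b → Continuous G → (∀ z, 0 ≤ G z) → ∫ z in {z : E3 | a ≤ ‖z - x‖ ∧ ‖z - x‖ ≤ b}, G z ≤ e * (b - a) → ∃ σ ∈ Set.Icc a b, ∫⁻ w, ENNReal.ofReal (σ ^ 2 * G (x + σ • (w : E3))) ∂(volume : Measure E3).toSphere ≤ ENNReal.ofReal e :=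
  fun _ _ _ _ _ ha hab hG hG0 hint ↦ exists_radius_sphere_lintegral_le ha hab hG hG0 hint

end Summit.FinalStateConjecture.FinalStateConjecture.Theorems.NecksCertifyTwoCap.Huygens
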